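import Summits.BirchSwinnertonDyer.BirchSwinnertonDyer.Theorems.ResidualThetaTransportAtTwoThetaLayerLambdaCongruenceAtTwoHeckeAdjointHermite
import HarnessLib

/-!
# Crux `ThetaLayerLambdaCongruenceAtTwo` (stmt-BirchSwinnertonDyer-20688, route ResidualThetaTransportAtTwo), line
# `birth` v14 — SD floor, kernel road, Hecke clause of IP, brick HA4 (part 2 of 2) «CONVEX RE-EXPANSION»: an `SL₂(ℤ)`-equivariant
# one-sided Farey re-expansion of every generalised edge `C·{∞, 0}` (`C ∈ M₂(ℤ)`, `det C > 0`) (lead prover bsd-wall-rtt-p3 g13;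
# `--supports stmt-BirchSwinnertonDyer-20688 --as helper`; closes nothing)

HONEST FRAMING. Elementary THEOREMS about `2×2` integer matrices and lists of elements of `SL₂(ℤ)` (continued fractions, Hermite
normal form), in the currency of `…ManinChain` / `…DualChain*` (w2 g8) and of the plan `Cruxes/ThetaLayerLambdaCongruenceAtTwo/Lines/
birth-sd2-hecke-adjoint.md` §3 (D), §4 HA4 (w3 g11); no definition; nothing about any curve or form is asserted; BSD is not proved by any
of this.

WHAT. For an integer matrix `C = (a b; c d)` with `n = det C > 0` the GENERALISED EDGE of `C` is the oriented hyperbolic geodesic from the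
cusp `C∞ = a/c` to the cusp `C0 = b/d`; it is a Farey edge iff `C ∈ ℤ_{>0}·SL₂(ℤ)`. In the coordinate `t = C⁻¹z` (so that the edge becomes
`{∞, 0}` and its positive side — the side of `C·1` — becomes `Re t > 0`) a Farey edge `{f∞, f0}` (`f ∈ SL₂(ℤ)`) has the end points
`t, t'` whose homogeneous coordinates are the columns of `adj(C)·f` (`= n·C⁻¹f`, `det = n`). THEOREM `exists_convexReexpansion`: there is
ONE function `P : M₂(ℤ) → List SL₂(ℤ)` such that for every `C` with `det C > 0` the list `P(C) = [f₁, …, f_r]` is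
* a FAREY PATH from `C∞` to `C0`: `r ≥ 1`, the first column of `f₁` is the primitive vector of `C∞` (`C e₀ = m·f₁e₀`, `m > 0`), consecutive
  edges share their vertex (`f_i e₁ = f_{i+1} e₀`, as vectors), the second column of `f_r` is the primitive vector of `C0`;
* CONVEX / ONE-SIDED: every entry of `adj(C)·f_i` is `≥ 0` — i.e. all vertices `t₁ = ∞ > t₂ > ⋯ > t_r > t_{r+1} = 0` lie on the closure of
  the positive side of the edge and the `t`-intervals of the edges of `P(C)` PARTITION `[0, ∞]` (the polygon `C∞, t₂, …, t_r, C0` is an ideal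
  polygon lying on one side of the generalised edge — the input of the discrete Jordan lemma, brick HA5);
* EQUIVARIANT: `P(u·C) = u·P(C)` for `u ∈ SL₂(ℤ)` (literally, as lists — the input of the `Γ₀(N)`-re-indexing of brick HA6);
* hence TELESCOPING over cusp functions: `Σ_{f∈P(C)} (F f − F(fS)) = F k₁ − F k₂` for every `F : SL₂(ℤ) → A` with `F(gT) = F g`, `F(−g) = F g`
  and all `k₁, k₂ ∈ SL₂(ℤ)` with `k₁∞ = C∞`, `k₂∞ = C0` — so concatenating `P(Mg)` over a Manin chain `g ∈ L_γ` re-expands the generalised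
  cusp path `M·L_γ` as a Manin chain (memo step (D), brick HA7).
Construction: Hermite normal form `C = v_C⁻¹·H`, `H = (a b; 0 d)`, `0 ≤ b < d` (unique: part 1, §3) and (§1) the ceiling (negative-regular,
Hirzebruch–Jung) continued fraction of `b/d`, whose convergents decrease from `⌈b/d⌉` to `b/d` through Farey neighbours; `P(C) := v_C⁻¹·P₀(H)`.

References: [Manin1972] §1.5–1.7, Thm. 1.6 (Farey paths, Manin's trick); [CremonaAlgorithms1997] §2.2 (M-symbols, continued fractions);
[Shimura1971] §3.3 (upper-triangular representatives); F. Hirzebruch, Hilbert modular surfaces, Enseign. Math. 19 (1973), §2.3 (ceiling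
continued fractions and convex ideal polygons).
-/

set_option autoImplicit false

noncomputable section

-- justification: the `Summit.BirchSwinnertonDyer.BirchSwinnertonDyer.…` path repeats a component (route-file convention)
set_option linter.dupNamespace false

open scoped Classical MatrixGroups

open CongruenceSubgroup Matrix.SpecialLinearGroup ModularGroup
open Literature.NumberTheory.EllipticCurves.ModularForms

namespace Summit.BirchSwinnertonDyer.BirchSwinnertonDyer.Theorems.ThetaLayerLambdaCongruenceAtTwo

/-! ## §1. The ceiling continued fraction: a convex Farey path from `∞` to `b/d` -/

section Ceiling

/-- Entries of `Tᶜ`. [folklore] -/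
theorem T_zpow_apply (c : ℤ) : (T ^ c) 0 0 = 1 ∧ (T ^ c) 0 1 = c ∧ (T ^ c) 1 0 = 0 ∧ (T ^ c) 1 1 = 1 := by
  refine ⟨?_, ?_, ?_, ?_⟩ <;> simp [coe_T_zpow]

/-- **The ceiling (Hirzebruch–Jung) continued fraction as a convex Farey path.** For integers `b` and `d > 0` there is a non-empty list
`L = [f₁, …, f_r]` in `SL₂(ℤ)` with: `f₁ e₀ = (1, 0)` (the path starts at `∞`), `(b, d) = m·f_r e₁` with `m > 0` (it ends at `b/d`),
consecutive edges share their vertex, and for every `f ∈ L` and both columns `(p, q)` of `f`: `q ≥ 0` and `dp − bq ≥ 0` — all vertices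
`∞ = c₁ > c₂ > ⋯ > b/d` lie weakly to the right of `b/d` (`cᵢ ≥ b/d`), i.e. the path is CONVEX (one-sided and monotone). Construction:
`c = ⌈b/d⌉`, `r = cd − b ∈ [0, d)`; if `r = 0` the path is the single edge `Tᶜ = {∞, c}`; otherwise it is `Tᶜ` followed by the image under
`z ↦ c − 1/z` (the matrix `TᶜS`) of the path from `∞` to `d/r` (induction on `d`). [cite: CremonaAlgorithms1997, §2.2]
[cite: Manin1972, Thm. 1.6] -/
theorem exists_ceilingPath (b d : ℤ) (hd : 0 < d) :
    ∃ L : List SL(2, ℤ), ∃ f₁ ∈ L.head?, ∃ f₂ ∈ L.getLast?,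
      (f₁ 0 0 = 1 ∧ f₁ 1 0 = 0) ∧
      (∃ m : ℤ, 0 < m ∧ b = m * f₂ 0 1 ∧ d = m * f₂ 1 1) ∧
      List.IsChain (fun f g : SL(2, ℤ) ↦ f 0 1 = g 0 0 ∧ f 1 1 = g 1 0) L ∧
      ∀ f ∈ L, ∀ j : Fin 2, 0 ≤ f 1 j ∧ 0 ≤ d * f 0 j - b * f 1 j := by
  suffices H : ∀ n : ℕ, ∀ b d : ℤ, 0 < d → d.toNat = n →
      ∃ L : List SL(2, ℤ), ∃ f₁ ∈ L.head?, ∃ f₂ ∈ L.getLast?,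
        (f₁ 0 0 = 1 ∧ f₁ 1 0 = 0) ∧
        (∃ m : ℤ, 0 < m ∧ b = m * f₂ 0 1 ∧ d = m * f₂ 1 1) ∧
        List.IsChain (fun f g : SL(2, ℤ) ↦ f 0 1 = g 0 0 ∧ f 1 1 = g 1 0) L ∧
        ∀ f ∈ L, ∀ j : Fin 2, 0 ≤ f 1 j ∧ 0 ≤ d * f 0 j - b * f 1 j from H _ b d hd rfl
  intro n
  induction n using Nat.strong_induction_on with
  | _ n ih =>
  intro b d hd hn
  obtain ⟨hT00, hT01, hT10, hT11⟩ := T_zpow_apply (-((-b) / d))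
  set c : ℤ := -((-b) / d) with hc
  set r : ℤ := (-b) % d with hr
  have hr0 : 0 ≤ r := Int.emod_nonneg _ hd.ne'
  have hrd : r < d := Int.emod_lt_of_pos _ hd
  have hcr : c * d - b = r := by
    have e := Int.emod_def (-b) d
    rw [hc, hr]
    linear_combination (-1 : ℤ) * e
  -- the first edge `Tᶜ = {∞, c}` is one-sided: its vertices are `∞` and `c ≥ b/d`
  have hTside : ∀ j : Fin 2, 0 ≤ (T ^ c) 1 j ∧ 0 ≤ d * (T ^ c) 0 j - b * (T ^ c) 1 j := by
    refine Fin.forall_fin_two.mpr ⟨⟨by rw [hT10], ?_⟩, ⟨by rw [hT11]; exact zero_le_one, ?_⟩⟩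
    · rw [hT00, hT10, mul_one, mul_zero, sub_zero]; exact hd.le
    · rw [hT01, hT11, mul_one, mul_comm, hcr]; exact hr0
  by_cases hr00 : r = 0
  · -- one edge `{∞, c}`, `b/d = c`
    refine ⟨[T ^ c], T ^ c, by simp, T ^ c, by simp, ⟨hT00, hT10⟩, ⟨d, hd, ?_, ?_⟩, List.isChain_singleton _, ?_⟩
    · rw [hT01]; linear_combination (-1 : ℤ) * hcr - hr00
    · rw [hT11, mul_one]
    · intro f hf j
      rw [List.mem_singleton] at hf
      subst hf
      exact hTside j
  · -- `Tᶜ` followed by `TᶜS`·(path from `∞` to `d/r`)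
    have hrpos : 0 < r := lt_of_le_of_ne hr0 (Ne.symm hr00)
    have hlt : r.toNat < n := by
      rw [← hn]
      exact (Int.toNat_lt_toNat hd).mpr hrd
    obtain ⟨L', f₁', hf₁', f₂', hf₂', ⟨h00', h10'⟩, ⟨m', hm'0, hbm', hdm'⟩, hch', hside'⟩ := ih _ hlt d r hrpos rfl
    -- `L'` is non-empty
    obtain ⟨L'', rfl⟩ : ∃ L'', L' = f₁' :: L'' := by
      cases L' with
      | nil => simp at hf₁'
      | cons x L'' =>
        refine ⟨L'', ?_⟩
        simp only [List.head?_cons, Option.mem_def, Option.some.injEq] at hf₁'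
        rw [hf₁']
    set g : SL(2, ℤ) := T ^ c * S with hg
    have hgf : ∀ (f : SL(2, ℤ)) (j : Fin 2), (g * f) 0 j = c * f 0 j - f 1 j ∧ (g * f) 1 j = f 0 j := fun f j ↦ by
      rw [hg]; exact T_zpow_mul_S_mul_apply c f j
    refine ⟨T ^ c :: (f₁' :: L'').map (fun f ↦ g * f), T ^ c, by simp, g * f₂', ?_, ⟨hT00, hT10⟩,
      ⟨m', hm'0, ?_, ?_⟩, ?_, ?_⟩
    · -- the last edge is `g·f₂'`
      rw [List.map_cons, List.getLast?_cons_cons, ← List.map_cons, List.getLast?_map]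
      rw [Option.mem_def] at hf₂' ⊢
      rw [hf₂', Option.map_some]
    · rw [(hgf f₂' 1).1]
      linear_combination (-1 : ℤ) * hcr + c * hbm' - hdm'
    · rw [(hgf f₂' 1).2]; exact hbm'
    · rw [List.map_cons, List.isChain_cons_cons]
      refine ⟨⟨?_, ?_⟩, ?_⟩
      · rw [hT01, (hgf f₁' 0).1, h00', h10', mul_one, sub_zero]
      · rw [hT11, (hgf f₁' 0).2, h00']
      · rw [← List.map_cons]
        exact isChain_map_mul_left g hch'
    · intro f hf j
      rw [List.mem_cons] at hf
      rcases hf with rfl | hf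
      · exact hTside j
      · obtain ⟨f', hf', rfl⟩ := List.mem_map.mp hf
        obtain ⟨h1, h2⟩ := hside' f' hf' j
        rw [(hgf f' j).1, (hgf f' j).2]
        have h3 : 0 ≤ d * f' 1 j := mul_nonneg hd.le h1
        refine ⟨by nlinarith, ?_⟩
        have e : d * (c * f' 0 j - f' 1 j) - b * f' 0 j = r * f' 0 j - d * f' 1 j := by
          linear_combination (f' 0 j) * hcr
        rw [e]; exact h2

end Ceiling

/-! ## §2. The equivariant convex re-expansion of generalised edges -/

section Reexpansion

/-- **HA4 — the `SL₂(ℤ)`-equivariant convex (one-sided) Farey re-expansion of generalised edges.** There is ONE function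
`P : M₂(ℤ) → List SL₂(ℤ)` with `P(u·C) = u·P(C)` for all `u ∈ SL₂(ℤ)` and all `C`, such that for every `C` with `det C > 0` the list
`P(C) = [f₁, …, f_r]` is a Farey path from the cusp `C∞` (`C e₀ = m·f₁e₀`, `m > 0`) to the cusp `C0` (`C e₁ = m'·f_r e₁`, `m' > 0`) with
consecutive edges sharing their vertex, all of whose edges lie on the closure of the POSITIVE side of the generalised edge `C·{∞,0}` and
descend monotonically in the coordinate `t = C⁻¹z` (every entry of `adj(C)·f_i = det(C)·C⁻¹f_i` is `≥ 0`; with `det = det C > 0` this says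
`∞ = t₁ > t₂ > ⋯ > t_{r+1} = 0`, the `t`-intervals of the edges partitioning `[0, ∞]`), and which therefore telescopes over cusp functions:
`Σ_{f∈P(C)} (F f − F(fS)) = F k₁ − F k₂` whenever `k₁∞ = C∞`, `k₂∞ = C0`. (`P(C) = v_C⁻¹·P₀(v_C C)` with `v_C C` the Hermite normal form of
part 1, and `P₀` the ceiling continued fraction path of §1; equivariance is the uniqueness of the normal form.) This is brick HA4 of the Hecke
clause of IP (`Cruxes/…/Lines/birth-sd2-hecke-adjoint.md` §3 (D), §4): concatenated over a Manin chain `g ∈ L_γ`, the lists `P(Mg)` re-expand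
the generalised cusp path `M·L_γ` of a Hecke representative `M` as a Manin chain, one-sidedly, and compatibly with the `Γ₀(N)`-re-indexing.
[cite: Manin1972, §1.5–1.7, Thm. 1.6] [cite: Shimura1971, §3.3] [cite: CremonaAlgorithms1997, §2.2] -/
theorem exists_convexReexpansion :
    ∃ P : Matrix (Fin 2) (Fin 2) ℤ → List SL(2, ℤ),
      (∀ (u : SL(2, ℤ)) (C : Matrix (Fin 2) (Fin 2) ℤ),
          P ((u : Matrix (Fin 2) (Fin 2) ℤ) * C) = (P C).map fun f ↦ u * f) ∧
      ∀ C : Matrix (Fin 2) (Fin 2) ℤ, 0 < C.det →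
        (∃ f₁ ∈ (P C).head?, ∃ m : ℤ, 0 < m ∧ C 0 0 = m * f₁ 0 0 ∧ C 1 0 = m * f₁ 1 0) ∧
        (∃ f₂ ∈ (P C).getLast?, ∃ m : ℤ, 0 < m ∧ C 0 1 = m * f₂ 0 1 ∧ C 1 1 = m * f₂ 1 1) ∧
        List.IsChain (fun f g : SL(2, ℤ) ↦ f 0 1 = g 0 0 ∧ f 1 1 = g 1 0) (P C) ∧
        (∀ f ∈ P C, ∀ i j : Fin 2, 0 ≤ (C.adjugate * (f : Matrix (Fin 2) (Fin 2) ℤ)) i j) ∧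
        ∀ {A : Type} [AddCommGroup A] (F : SL(2, ℤ) → A), (∀ g, F (g * T) = F g) → (∀ g, F (-g) = F g) →
          ∀ k₁ k₂ : SL(2, ℤ), C 0 0 * k₁ 1 0 = C 1 0 * k₁ 0 0 → C 0 1 * k₂ 1 0 = C 1 1 * k₂ 0 0 →
            ((P C).map fun f ↦ F f - F (f * S)).sum = F k₁ - F k₂ := by
  -- Hermite reduction `v C` (so that `v C · C` is in normal form; `1` off the positive-determinant locus)
  let v : Matrix (Fin 2) (Fin 2) ℤ → SL(2, ℤ) := fun C ↦
    if h : 0 < C.det then Classical.choose (exists_sl2_mul_hermite C h) else 1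
  have hv : ∀ C : Matrix (Fin 2) (Fin 2) ℤ, ∀ h : 0 < C.det,
      ((v C : Matrix (Fin 2) (Fin 2) ℤ) * C) 1 0 = 0 ∧ 0 < ((v C : Matrix (Fin 2) (Fin 2) ℤ) * C) 1 1 ∧
      0 ≤ ((v C : Matrix (Fin 2) (Fin 2) ℤ) * C) 0 1 ∧
      ((v C : Matrix (Fin 2) (Fin 2) ℤ) * C) 0 1 < ((v C : Matrix (Fin 2) (Fin 2) ℤ) * C) 1 1 := by
    intro C h
    have e : v C = Classical.choose (exists_sl2_mul_hermite C h) := dif_pos h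
    rw [e]
    exact Classical.choose_spec (exists_sl2_mul_hermite C h)
  -- the normal-form path
  let P₀ : Matrix (Fin 2) (Fin 2) ℤ → List SL(2, ℤ) := fun H ↦
    if h : 0 < H 1 1 then Classical.choose (exists_ceilingPath (H 0 1) (H 1 1) h) else []
  have hP₀ : ∀ H : Matrix (Fin 2) (Fin 2) ℤ, ∀ h : 0 < H 1 1,
      ∃ f₁ ∈ (P₀ H).head?, ∃ f₂ ∈ (P₀ H).getLast?,
        (f₁ 0 0 = 1 ∧ f₁ 1 0 = 0) ∧
        (∃ m : ℤ, 0 < m ∧ H 0 1 = m * f₂ 0 1 ∧ H 1 1 = m * f₂ 1 1) ∧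
        List.IsChain (fun f g : SL(2, ℤ) ↦ f 0 1 = g 0 0 ∧ f 1 1 = g 1 0) (P₀ H) ∧
        ∀ f ∈ P₀ H, ∀ j : Fin 2, 0 ≤ f 1 j ∧ 0 ≤ H 1 1 * f 0 j - H 0 1 * f 1 j := by
    intro H h
    have e : P₀ H = Classical.choose (exists_ceilingPath (H 0 1) (H 1 1) h) := dif_pos h
    rw [e]
    exact Classical.choose_spec (exists_ceilingPath (H 0 1) (H 1 1) h)
  -- the re-expansion
  let P : Matrix (Fin 2) (Fin 2) ℤ → List SL(2, ℤ) := fun C ↦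
    if 0 < C.det then (P₀ ((v C : Matrix (Fin 2) (Fin 2) ℤ) * C)).map (fun f ↦ (v C)⁻¹ * f) else []
  have hPpos : ∀ C : Matrix (Fin 2) (Fin 2) ℤ, 0 < C.det →
      P C = (P₀ ((v C : Matrix (Fin 2) (Fin 2) ℤ) * C)).map (fun f ↦ (v C)⁻¹ * f) := fun C h ↦ if_pos h
  have hPneg : ∀ C : Matrix (Fin 2) (Fin 2) ℤ, ¬ 0 < C.det → P C = [] := fun C h ↦ if_neg h
  refine ⟨P, fun u C ↦ ?_, fun C hC ↦ ?_⟩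
  · -- EQUIVARIANCE: `v (uC) = v C · u⁻¹` by uniqueness of the normal form
    have hdet : ((u : Matrix (Fin 2) (Fin 2) ℤ) * C).det = C.det := by
      rw [Matrix.det_mul, Matrix.SpecialLinearGroup.det_coe, one_mul]
    by_cases hC : 0 < C.det
    · have hC' : 0 < ((u : Matrix (Fin 2) (Fin 2) ℤ) * C).det := by rw [hdet]; exact hC
      have key : v ((u : Matrix (Fin 2) (Fin 2) ℤ) * C) = v C * u⁻¹ := by
        obtain ⟨a1, a2, a3, a4⟩ := hv _ hC'
        obtain ⟨b1, b2, b3, b4⟩ := hv C hC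
        have e : ((v C * u⁻¹ : SL(2, ℤ)) : Matrix (Fin 2) (Fin 2) ℤ) * ((u : Matrix (Fin 2) (Fin 2) ℤ) * C) =
            (v C : Matrix (Fin 2) (Fin 2) ℤ) * C := by
          rw [coe_mul, Matrix.mul_assoc, ← Matrix.mul_assoc ((u⁻¹ : SL(2, ℤ)) : Matrix (Fin 2) (Fin 2) ℤ), ← coe_mul,
            inv_mul_cancel, Matrix.SpecialLinearGroup.coe_one, Matrix.one_mul]
        refine sl2_mul_hermite_unique _ hC' _ _ a1 a2 a3 a4 ?_ ?_ ?_ ?_ <;> rw [e]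
        · exact b1
        · exact b2
        · exact b3
        · exact b4
      have eH : ((v ((u : Matrix (Fin 2) (Fin 2) ℤ) * C) : SL(2, ℤ)) : Matrix (Fin 2) (Fin 2) ℤ) *
          ((u : Matrix (Fin 2) (Fin 2) ℤ) * C) = (v C : Matrix (Fin 2) (Fin 2) ℤ) * C := by
        rw [key, coe_mul, Matrix.mul_assoc, ← Matrix.mul_assoc ((u⁻¹ : SL(2, ℤ)) : Matrix (Fin 2) (Fin 2) ℤ), ← coe_mul,
          inv_mul_cancel, Matrix.SpecialLinearGroup.coe_one, Matrix.one_mul]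
      rw [hPpos _ hC', hPpos C hC, eH, key, List.map_map]
      refine List.map_congr_left fun f _ ↦ ?_
      simp only [Function.comp_apply, mul_inv_rev, inv_inv, mul_assoc]
    · rw [hPneg C hC, hPneg _ (by rw [hdet]; exact hC), List.map_nil]
  · -- the properties on the positive-determinant locus, transported from the normal form `H = v C · C`
    obtain ⟨h10, h11, h01, h01'⟩ := hv C hC
    set H : Matrix (Fin 2) (Fin 2) ℤ := (v C : Matrix (Fin 2) (Fin 2) ℤ) * C with hHdef
    set w : SL(2, ℤ) := (v C)⁻¹ with hw
    have hdetH : H.det = C.det := by rw [hHdef, Matrix.det_mul, Matrix.SpecialLinearGroup.det_coe, one_mul]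
    have h00 : 0 < H 0 0 := by
      have e : H 0 0 * H 1 1 = C.det := by rw [← hdetH, Matrix.det_fin_two, h10, mul_zero, sub_zero]
      nlinarith
    have hCw : C = (w : Matrix (Fin 2) (Fin 2) ℤ) * H := by
      rw [hw, hHdef, ← Matrix.mul_assoc, ← coe_mul, inv_mul_cancel, Matrix.SpecialLinearGroup.coe_one, Matrix.one_mul]
    have hCi0 : ∀ i, C i 0 = w i 0 * H 0 0 := fun i ↦ by
      rw [hCw]; simp [Matrix.mul_apply, Fin.sum_univ_two, h10]
    have hCi1 : ∀ i, C i 1 = w i 0 * H 0 1 + w i 1 * H 1 1 := fun i ↦ by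
      rw [hCw]; simp [Matrix.mul_apply, Fin.sum_univ_two]
    obtain ⟨f₁, hf₁, f₂, hf₂, ⟨hf₁00, hf₁10⟩, ⟨m, hm0, hm01, hm11⟩, hch, hside⟩ := hP₀ H h11
    have hPC : P C = (P₀ H).map (fun f ↦ w * f) := hPpos C hC
    -- `P₀ H = f₁ :: L₀`
    obtain ⟨L₀, hL₀⟩ : ∃ L₀, P₀ H = f₁ :: L₀ := by
      cases hP : P₀ H with
      | nil => rw [hP] at hf₁; simp at hf₁
      | cons x L₀ =>
        refine ⟨L₀, ?_⟩
        rw [hP] at hf₁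
        simp only [List.head?_cons, Option.mem_def, Option.some.injEq] at hf₁
        rw [hf₁]
    have hwf₁ : ∀ i, (w * f₁) i 0 = w i 0 := fun i ↦ by
      simp [coe_mul, Matrix.mul_apply, Fin.sum_univ_two, hf₁00, hf₁10]
    have hwf₂ : ∀ i, m * (w * f₂) i 1 = C i 1 := fun i ↦ by
      rw [hCi1 i, hm01, hm11]
      simp only [coe_mul, Matrix.mul_apply, Fin.sum_univ_two]
      ring
    have hlast : (P C).getLast? = some (w * f₂) := by
      rw [hPC, List.getLast?_map]
      rw [Option.mem_def] at hf₂
      rw [hf₂, Option.map_some]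
    refine ⟨⟨w * f₁, ?_, H 0 0, h00, ?_, ?_⟩, ⟨w * f₂, ?_, m, hm0, (hwf₂ 0).symm, (hwf₂ 1).symm⟩, ?_, ?_, ?_⟩
    · rw [hPC, hL₀, List.map_cons, List.head?_cons, Option.mem_def]
    · rw [hwf₁, hCi0, mul_comm]
    · rw [hwf₁, hCi0, mul_comm]
    · rw [hlast, Option.mem_def]
    · rw [hPC]; exact isChain_map_mul_left w hch
    · -- ONE-SIDEDNESS: `adj(C)·(w f) = adj(H)·f` has rows `(d f₀ⱼ − b f₁ⱼ)` and `(a f₁ⱼ)`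
      intro f hf
      rw [hPC] at hf
      obtain ⟨f₀, hf₀, rfl⟩ := List.mem_map.mp hf
      have eadj : C.adjugate * ((w * f₀ : SL(2, ℤ)) : Matrix (Fin 2) (Fin 2) ℤ) = H.adjugate * (f₀ : Matrix (Fin 2) (Fin 2) ℤ) := by
        rw [adjugate_mul_coe_mul, hw, inv_inv]
      rw [eadj]
      refine Fin.forall_fin_two.mpr ⟨fun j ↦ ?_, fun j ↦ ?_⟩
      · rw [(adjugate_mul_apply H f₀ j).1]; exact (hside f₀ hf₀ j).2
      · rw [(adjugate_mul_apply H f₀ j).2, h10, zero_mul, sub_zero]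
        exact mul_nonneg h00.le (hside f₀ hf₀ j).1
    · -- TELESCOPING
      intro A _ F hT hneg k₁ k₂ hk₁ hk₂
      have hPC' : P C = (w * f₁) :: L₀.map (fun f ↦ w * f) := by rw [hPC, hL₀, List.map_cons]
      have hch' : List.IsChain (fun f g : SL(2, ℤ) ↦ f 0 1 = g 0 0 ∧ f 1 1 = g 1 0) ((w * f₁) :: L₀.map (fun f ↦ w * f)) := by
        rw [← List.map_cons, ← hL₀]; exact isChain_map_mul_left w hch
      rw [hPC', sum_map_sub_eq_of_isChain F hT hneg (w * f₁) _ hch']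
      -- the last edge
      have elast : ((w * f₁) :: L₀.map (fun f ↦ w * f)).getLast (List.cons_ne_nil _ _) = w * f₂ := by
        apply Option.some_injective _
        rw [← hlast, hPC', List.getLast?_eq_getLast_of_ne_nil]
      rw [elast]
      congr 1
      · -- `F(w f₁) = F k₁`: both first columns are positive multiples of `C e₀`
        refine apply_eq_of_col_zero_parallel F hT hneg _ _ ?_
        have e0 := hCi0 0
        have e1 := hCi0 1
        rw [hwf₁, hwf₁]
        have : H 0 0 * (w 0 0 * k₁ 1 0) = H 0 0 * (w 1 0 * k₁ 0 0) := by
          have := hk₁; rw [e0, e1] at this; linear_combination this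
        exact mul_left_cancel₀ h00.ne' this
      · -- `F(w f₂ S) = F k₂`: the first column of `w f₂ S` is the second column of `w f₂`, a positive multiple of `C e₁`
        refine apply_eq_of_col_zero_parallel F hT hneg _ _ ?_
        rw [(mul_S_apply (w * f₂)).1, (mul_S_apply (w * f₂)).2.2.1]
        have e0 := hwf₂ 0
        have e1 := hwf₂ 1
        have : m * ((w * f₂) 0 1 * k₂ 1 0) = m * ((w * f₂) 1 1 * k₂ 0 0) := by
          have := hk₂; rw [← e0, ← e1] at this; linear_combination this
        exact mul_left_cancel₀ hm0.ne' this

end Reexpansion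

end Summit.BirchSwinnertonDyer.BirchSwinnertonDyer.Theorems.ThetaLayerLambdaCongruenceAtTwo

end
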